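import Literature.IUT.HodgeTheaters.PlaceKitBridge
import Literature.IUT.HodgeTheaters.TruncatedPlaceKitBridge
import HarnessLib

/-!
# C9-d / RULING D13: a place kit over ALL of `V̲` (β) RESTRICTS to a truncated kit at every finite `S` (α)

Mochizuki, *Inter-universal Teichmüller Theory I*, kurims manuscript (May 2020), §3 Def 3.1 (e) p.62, §6 Def 6.1 pp.155–159
[cite: Mochizuki2012, I Def 3.1 (e) p.62, I Def 6.1 p.155]
(D-0012 claim key, status disputed; BRIDGE plumbing — nothing of the series is asserted).

MERGE-MAP plan/L6/MERGE-MAP.md §4 C9-d / §8 B11, RULING D13.  After B11 (p414335) abc-iut-L5-t4 landed the (β) bridge of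
record `InitialThetaData.PlaceKit` (`PlaceKitBridge.lean`: a kit whose index set IS the infinite `V̲`), in the shape of
abc-iut-L6-t7's (α) family `InitialThetaData.TruncatedKit D S` (`TruncatedPlaceKitBridge.lean`), and left "the comparison
with the truncated family (`PlaceKit ↦ TruncatedKit D S` for every finite `S` …)" to "a separate sibling file over
`TruncatedPlaceKitBridge`".  THIS IS THAT SIBLING: `PlaceKit.restrict S` re-indexes a place kit along `V̲_S ↪ V̲` (read through a
`Fin`-enumeration of the finite `V̲_S`; abc-iut-L5-t4's `PMBaseKit.reindex'`) and yields a truncated kit at `S` — so every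
decl read over the (α) family (RULING D13's reading of `[Fintype V]`-indexed statements) is an instance of its (β) reading
over a place kit; `restrict_val`, `restrict_Amb`, `restrict_model` say the restriction changes nothing but the index set.
-/

namespace Literature.IUT.HodgeTheaters

open CategoryTheory

universe uK u v w

section Places

variable {F : Type u} {K : Type v} {Fbar : Type w} [Field F] [NumberField F] [Field K]
  [NumberField K] [Algebra F K] [Field Fbar] [Algebra F Fbar] [Algebra K Fbar]
  {E : WeierstrassCurve F} [E.IsElliptic] {l : ℕ} {P : BadPlacePredicates K}
  {D : InitialThetaData F K Fbar E l P}

namespace InitialThetaData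

namespace PlaceKit

open scoped Classical in
/-- **IUTchI:Def3.1(e)** (kurims p.62) **Restriction of a place kit to a finite truncation** `S ⊆ V_mod`: re-index along
`V̲_S = {v̲ | v ∈ S} ↪ V̲` (through a `Fin`-enumeration of the finite `V̲_S`), cutting out the bad / archimedean indices by
`V̲^bad` / `V̲^arc` (equivalently, by `mem_bad_iff` / `mem_arc_iff`, the preimages of the place kit's). The result is a
truncated kit at `S` in the sense of abc-iut-L6-t7's `TruncatedKit`. [claim: Mochizuki2012, status: disputed] -/
noncomputable def restrict (T : PlaceKit.{uK} D) (S : Finset (Val (fieldOfModuli E))) : TruncatedKit.{uK} D S :=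
  let W : Set (Val K) := D.VOver (S : Set (Val (fieldOfModuli E)))
  let ε : Fin (Fintype.card ↥W) ≃ ↥W := (Fintype.equivFin ↥W).symm
  { kit := T.kit.reindex' (Fin (Fintype.card ↥W)) (fun i => T.e.symm ⟨(ε i : Val K), (ε i).2.1⟩)
      (Finset.univ.filter fun i => ((ε i : ↥W) : Val K) ∈ D.Vbad)
      (Finset.univ.filter fun i => ((ε i : ↥W) : Val K) ∈ D.Varc)
    e := ε
    mem_bad_iff := fun i =>
      (Finset.mem_filter (s := (Finset.univ : Finset (Fin (Fintype.card ↥W)))) (a := i)).trans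
        (and_iff_right (Finset.mem_univ (α := Fin (Fintype.card ↥W)) i))
    mem_arc_iff := fun i =>
      (Finset.mem_filter (s := (Finset.univ : Finset (Fin (Fintype.card ↥W)))) (a := i)).trans
        (and_iff_right (Finset.mem_univ (α := Fin (Fintype.card ↥W)) i)) }

/-- **IUTchI:Def3.1(e)** (kurims p.62) The restriction indexes `V̲_S` by its `Fin`-enumeration: the valuation at index `i` is the
`i`-th element of `V̲_S`. [claim: Mochizuki2012, status: disputed] -/
theorem restrict_val (T : PlaceKit.{uK} D) (S : Finset (Val (fieldOfModuli E))) (i : (T.restrict S).kit.V) :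
    (T.restrict S).val i = (((Fintype.equivFin ↥(D.VOver (S : Set (Val (fieldOfModuli E))))).symm i :
      ↥(D.VOver (S : Set (Val (fieldOfModuli E))))) : Val K) := rfl

/-- **IUTchI:Def3.1(e)** (kurims p.62) The restricted kit's valuation at `i` is a valuation of the place kit: it is `T.val` of the
corresponding index of `V̲`. [claim: Mochizuki2012, status: disputed] -/
theorem restrict_val_eq (T : PlaceKit.{uK} D) (S : Finset (Val (fieldOfModuli E))) (i : (T.restrict S).kit.V) :
    (T.restrict S).val i = T.val (T.e.symm ⟨(T.restrict S).val i, (T.restrict S).val_mem_V i⟩) := by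
  rw [PlaceKit.val, Equiv.apply_symm_apply]

/-- **IUTchI:Def6.1** (kurims p.156) The ambient category of the restriction at index `i` IS the place kit's at the corresponding index
of `V̲` (nothing but the index set changes). [claim: Mochizuki2012, status: disputed] -/
theorem restrict_Amb (T : PlaceKit.{uK} D) (S : Finset (Val (fieldOfModuli E))) (i : (T.restrict S).kit.V) :
    (T.restrict S).kit.Amb i = T.kit.Amb (T.e.symm ⟨(T.restrict S).val i, (T.restrict S).val_mem_V i⟩) := rfl

/-- **IUTchI:Def6.1** (kurims p.156) … and so is the model `𝒟_v`. [claim: Mochizuki2012, status: disputed] -/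
theorem restrict_model (T : PlaceKit.{uK} D) (S : Finset (Val (fieldOfModuli E))) (i : (T.restrict S).kit.V) :
    (T.restrict S).kit.model i = T.kit.model (T.e.symm ⟨(T.restrict S).val i, (T.restrict S).val_mem_V i⟩) := rfl

/-- **IUTchI:Def3.1(e)** (kurims p.62) The bad indices of the restriction are exactly the indices whose valuation is bad for the place kit
(the truncation loses no bad index when `S` is admissible: `TruncatedKit.val_image_bad`). [claim: Mochizuki2012, status: disputed] -/
theorem restrict_mem_bad_iff (T : PlaceKit.{uK} D) (S : Finset (Val (fieldOfModuli E))) (i : (T.restrict S).kit.V) :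
    i ∈ (T.restrict S).kit.bad ↔ T.e.symm ⟨(T.restrict S).val i, (T.restrict S).val_mem_V i⟩ ∈ T.kit.bad := by
  rw [(T.restrict S).mem_bad_iff, T.mem_bad_iff, Equiv.apply_symm_apply]
  rfl

/-- **IUTchI:Def6.1** (kurims p.156) **Non-vacuity of the comparison**: abc-iut-L5-t4's toy place kit restricts, at every finite `S`, to a truncated kit
(an inhabitant of abc-iut-L6-t7's hypothesis structure obtained from the (β) side rather than built by hand).
[claim: Mochizuki2012, status: disputed] -/
noncomputable def restrictToy (D : InitialThetaData F K Fbar E l P) (S : Finset (Val (fieldOfModuli E))) :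
    TruncatedKit.{0} D S :=
  (PlaceKit.toy D).restrict S

end PlaceKit

end InitialThetaData

end Places

end Literature.IUT.HodgeTheaters
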